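import Summits.CriticalPhenomena.PercolationContinuityZ3.Theorems.PercNearOneGluingNoHeavyLowerTailSahiGridPatternCrossedCanonical

/-!
# `NoHeavyLowerTail` (crux stmt-CriticalPhenomena-4575), Sahi programme P1: the crossed family at the canonical certificate, **second unconditional
# sub-family: `A₀ ∩ B′ ⊆ V`** (e.g. `A₀ ⊆ V` or `B′ ⊆ V`; contains the whole two-arms family of generation 42) — every `k`, EVERY up-set `V`

Support file (Sahi cell, seat `prim-sahi-p1`, generation 43; `--supports stmt-CriticalPhenomena-4575`).  Pure proofs, no definitions, no `sorry`, standard axioms.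
Continuation of `…SahiGridPatternCrossedCanonical` (same vocabulary and setting: `S = x∨y` with `c = (0|4|2|5)`, `A = S×V`, inner vector `λ_V`, crossed pairs
`P = {x≥1}×A₀`, `Q = {q∈B′} ∪ ({y≥1}×B)`, `F = A₀∩B′`).

THE MATHEMATICS (seat memo FROM-prim-sahi-p1-gen43 §2.6).  Three PROVED upper bounds for the Kleitman difference `κ′ = κ′_V(A₀,B′)`:
(R1) `κ′ ≤ H_V(A₀)` (`kappa_le_harris_of_pairThird`);  (R2) `κ′ ≤ H_V(F) + h_V(B′,A₀)` (= goodness of `V` at `(A₀,B′)`);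
(R3) `κ′ ≤ 2^k#(F∩V) − N(V; F∩V)` — third-point Kleitman again, now with `X = A₀∩V`, `Y = B′`, `φ = 1 − 1_V` (this file, `kappa_le_harrisPlus`).  When `F ⊆ V` the
bound (R3) IS the Harris slack `H_V(F)`, so (CR′) `κ′ ≤ 2H_V(F) + h_V(A₀,B) + h_V(B,A₀)` holds outright (`cr_of_FsubV`), whence (reduction theorem of the companion
file) the crossed (N) at the canonical certificate and `sStarD ≥ 0` there, for every up-set `V` good at the two section rectangles:
`diagCert_coProduct_N_orTwo_crossed_canonical_of_FsubV`, `sStarD_blockAnd_orTwo_crossed_FsubV_nonneg`.  Together with the sub-family `A₀∩V ⊆ B` (route R1,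
companion file) the remaining crossed pairs are those with BOTH a point of `A₀∩V` outside `B` and a point of `A₀∩B′` outside `V`.  There (CR′) itself holds for
all up-sets of `[3]^k`, `k ≤ 3` (exhaustive with the minimising `B`, kit j295686) and in 220 000 random instances at `k = 4, 5`, but the three bounds are NOT enough:
`min(R1,R2,R3) ≤ 2H_V(F) + h_V(A₀,B) + h_V(B,A₀)` FAILS in 906 of the 941 192 000 triples `(V,A₀,B′) ⊆ [3]^3` with the adversarial `B` (kit j296207; e.g.
`V = ↑012 ∪ ↑102`, `A₀ = {y ≥ 1}`, `B′ = ↑220`, `B = {x = 2}`: `(R1,R2,R3) = (8,6,8)`, right side `4`, `κ′ = 2`) — a fourth, sharper bound on `κ′` (one that sees the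
pairs from `A₀∖V` whose third point lies in `V`) is needed exactly there (seat memo FROM-prim-sahi-p1-gen43 §2.6–2.7).
Nothing here asserts Conjecture A in general or `PatternPos d` for `d ≥ 4`. [this work]
-/

namespace Summit.CriticalPhenomena.PercolationContinuityZ3.Theorems.SahiGridPattern

open Finset SahiGrid3
open scoped BigOperators

section CrossedCanonicalSub

variable {k : ℕ} {S Fx Gy : Finset (Pd (1 + 1))} {V : Finset (Pd k)} {A : Finset (Pd ((1 + 1) + k))}

/-- **(R3): `κ′_V(A₀,B′) ≤ 2^k·#(A₀∩B′∩V) − #{(m,s) : m ∈ A₀∩B′∩V, m δ̸ s, s ∈ V}`** for up-sets `A₀, B′, V` (every `k`): drop the Latin triples whose first point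
is outside `V`, then Kleitman at every third point with `X = A₀∩V`, `Y = B′`, `φ = 1 − 1_V`. [this work] -/
theorem kappa_le_harrisPlus (hV : IsUpperSet (V : Set (Pd k))) {A0 Bp : Finset (Pd k)}
    (hA0 : IsUpperSet (A0 : Set (Pd k))) (hBp : IsUpperSet (Bp : Set (Pd k))) :
    (∑ q : Pd k, ∑ r : Pd k, ind A0 q * ind Bp r * (if TotDist q r = true then (1:ℤ) else 0) * ind V q)
      - (∑ q : Pd k, ∑ r : Pd k, ind A0 q * ind Bp r * (if TotDist q r = true then (1:ℤ) else 0) * ind V (thirdPt q r))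
      ≤ (2:ℤ) ^ k * (∑ q : Pd k, ind A0 q * ind Bp q * ind V q)
        - ∑ q : Pd k, ∑ r : Pd k, ind A0 q * ind V q * ind Bp q * (if TotDist q r = true then (1:ℤ) else 0) * ind V r := by
  have hφ : ∀ s : Pd k, 0 ≤ 1 - ind V s := by
    intro s; unfold ind; split_ifs <;> norm_num
  have hPT := pairThird_sum_le_inter (isUpperSet_inter_coe hA0 hV) hBp (fun s => 1 - ind V s) hφ
  -- (a) the Latin count is at least its part with `q ∈ V`
  have hmb : (∑ q : Pd k, ∑ r : Pd k, ind A0 q * ind V q * ind Bp r * (if TotDist q r = true then (1:ℤ) else 0) * ind V (thirdPt q r))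
      ≤ ∑ q : Pd k, ∑ r : Pd k, ind A0 q * ind Bp r * (if TotDist q r = true then (1:ℤ) else 0) * ind V (thirdPt q r) := by
    refine Finset.sum_le_sum fun q _ => Finset.sum_le_sum fun r _ => ?_
    have h1 : 0 ≤ ind A0 q := by unfold ind; split_ifs <;> norm_num
    have h2 : 0 ≤ ind Bp r := by unfold ind; split_ifs <;> norm_num
    have h3 : 0 ≤ (if TotDist q r = true then (1:ℤ) else 0) := by split_ifs <;> norm_num
    have h4 : 0 ≤ ind V (thirdPt q r) := by unfold ind; split_ifs <;> norm_num
    have h5 : ind V q ≤ 1 := by unfold ind; split_ifs <;> norm_num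
    nlinarith [mul_nonneg (mul_nonneg (mul_nonneg h1 h2) h3) h4]
  -- (b) the partner count has `q ∈ V` already: 1_V(q)·1_V(q) = 1_V(q)
  have hb : (∑ q : Pd k, ∑ r : Pd k, ind A0 q * ind Bp r * (if TotDist q r = true then (1:ℤ) else 0) * ind V q)
      = ∑ q : Pd k, ∑ r : Pd k, ind A0 q * ind V q * ind Bp r * (if TotDist q r = true then (1:ℤ) else 0) * 1 := by
    refine Finset.sum_congr rfl fun q _ => Finset.sum_congr rfl fun r _ => ?_; ring
  -- (c) rewrite the two sides of PT
  have eL : (∑ q : Pd k, ∑ r : Pd k, ind (A0 ∩ V) q * ind Bp r * (if TotDist q r = true then (1:ℤ) else 0) * (1 - ind V (thirdPt q r)))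
      = (∑ q : Pd k, ∑ r : Pd k, ind A0 q * ind V q * ind Bp r * (if TotDist q r = true then (1:ℤ) else 0) * 1)
        - ∑ q : Pd k, ∑ r : Pd k, ind A0 q * ind V q * ind Bp r * (if TotDist q r = true then (1:ℤ) else 0) * ind V (thirdPt q r) := by
    rw [← Finset.sum_sub_distrib]
    refine Finset.sum_congr rfl fun q _ => ?_
    rw [← Finset.sum_sub_distrib]
    refine Finset.sum_congr rfl fun r _ => ?_
    rw [ind_inter_eq_mul]; ring
  have eR : (∑ m : Pd k, ∑ s : Pd k, ind (A0 ∩ V) m * ind Bp m * (if TotDist m s = true then (1:ℤ) else 0) * (1 - ind V s))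
      = (2:ℤ) ^ k * (∑ q : Pd k, ind A0 q * ind Bp q * ind V q)
        - ∑ q : Pd k, ∑ r : Pd k, ind A0 q * ind V q * ind Bp q * (if TotDist q r = true then (1:ℤ) else 0) * ind V r := by
    rw [Finset.mul_sum, ← Finset.sum_sub_distrib]
    refine Finset.sum_congr rfl fun q _ => ?_
    have e5 : (∑ s : Pd k, ind (A0 ∩ V) q * ind Bp q * (if TotDist q s = true then (1:ℤ) else 0) * (1 - ind V s))
        = ind A0 q * ind V q * ind Bp q * (∑ s : Pd k, (if TotDist q s = true then (1:ℤ) else 0))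
          - ∑ s : Pd k, ind A0 q * ind V q * ind Bp q * (if TotDist q s = true then (1:ℤ) else 0) * ind V s := by
      rw [Finset.mul_sum, ← Finset.sum_sub_distrib]
      refine Finset.sum_congr rfl fun s _ => ?_
      rw [ind_inter_eq_mul]; ring
    rw [e5, sum_ite_totDist_eq_pow_left q]; ring
  rw [eL, eR] at hPT
  rw [hb]
  linarith

/-- **(CR′) whenever `A₀ ∩ B′ ⊆ V`, every `k`, all up-sets `A₀, B′, B, V`**: then (R3) is the Harris slack `H_V(A₀∩B′)` itself, and `H_V(F), h_V(A₀,B), h_V(B,A₀) ≥ 0`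
(Harris). [this work] -/
theorem cr_of_FsubV (hV : IsUpperSet (V : Set (Pd k))) {A0 Bp B0 : Finset (Pd k)}
    (hA0 : IsUpperSet (A0 : Set (Pd k))) (hBp : IsUpperSet (Bp : Set (Pd k))) (hB0 : IsUpperSet (B0 : Set (Pd k)))
    (hFV : A0 ∩ Bp ⊆ V) :
    (∑ q : Pd k, ∑ r : Pd k, ind A0 q * ind Bp r * (if TotDist q r = true then (1:ℤ) else 0) * ind V q)
      - (∑ q : Pd k, ∑ r : Pd k, ind A0 q * ind Bp r * (if TotDist q r = true then (1:ℤ) else 0) * ind V (thirdPt q r))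
      ≤ 2 * ((2:ℤ) ^ k * (∑ q : Pd k, ind A0 q * ind Bp q * ind V q)
              - ∑ q : Pd k, ∑ r : Pd k, ind A0 q * ind Bp q * (if TotDist q r = true then (1:ℤ) else 0) * ind V r)
        + ((2:ℤ) ^ k * (∑ q : Pd k, ind A0 q * ind B0 q * ind V q) - (∑ q : Pd k, ∑ r : Pd k, ind A0 q * ind B0 r * (if TotDist q r = true then (1:ℤ) else 0) * ind V q))
        + ((2:ℤ) ^ k * (∑ q : Pd k, ind A0 q * ind B0 q * ind V q) - (∑ q : Pd k, ∑ r : Pd k, ind A0 q * ind B0 r * (if TotDist q r = true then (1:ℤ) else 0) * ind V r)) := by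
  have h3 := kappa_le_harrisPlus hV hA0 hBp
  -- `F ⊆ V`: the weight 1_{A0}1_V1_{B′} equals 1_{A0}1_{B′}
  have eF : (∑ q : Pd k, ∑ r : Pd k, ind A0 q * ind V q * ind Bp q * (if TotDist q r = true then (1:ℤ) else 0) * ind V r)
      = ∑ q : Pd k, ∑ r : Pd k, ind A0 q * ind Bp q * (if TotDist q r = true then (1:ℤ) else 0) * ind V r := by
    refine Finset.sum_congr rfl fun q _ => Finset.sum_congr rfl fun r _ => ?_
    by_cases hq : q ∈ A0 ∩ Bp
    · have hqV : q ∈ V := hFV hq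
      rw [Finset.mem_inter] at hq
      have e1 : ind A0 q = 1 := by unfold ind; rw [if_pos hq.1]
      have e2 : ind Bp q = 1 := by unfold ind; rw [if_pos hq.2]
      have e3 : ind V q = 1 := by unfold ind; rw [if_pos hqV]
      rw [e1, e2, e3]; ring
    · rw [Finset.mem_inter, not_and_or] at hq
      rcases hq with hq | hq
      · have e1 : ind A0 q = 0 := by unfold ind; rw [if_neg hq]
        rw [e1]; ring
      · have e2 : ind Bp q = 0 := by unfold ind; rw [if_neg hq]
        rw [e2]; ring
  rw [eF] at h3
  have hH : (∑ q : Pd k, ∑ r : Pd k, ind A0 q * ind Bp q * (if TotDist q r = true then (1:ℤ) else 0) * ind V r)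
      ≤ (2:ℤ) ^ k * (∑ q : Pd k, ind A0 q * ind Bp q * ind V q) := by
    have h := pairCount_le_harris' (X := A0 ∩ Bp) (Y := (univ : Finset (Pd k))) hV (isUpperSet_inter_coe hA0 hBp)
      (by rw [Finset.coe_univ]; exact isUpperSet_univ)
    have e1 : (∑ q : Pd k, ∑ r : Pd k, ind (A0 ∩ Bp) q * ind (univ : Finset (Pd k)) r * (if TotDist q r = true then (1:ℤ) else 0) * ind V r)
        = ∑ q : Pd k, ∑ r : Pd k, ind A0 q * ind Bp q * (if TotDist q r = true then (1:ℤ) else 0) * ind V r := by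
      refine Finset.sum_congr rfl fun q _ => Finset.sum_congr rfl fun r _ => ?_
      rw [ind_inter_eq_mul, ind_univ_eq_one]; ring
    have e2 : (∑ q : Pd k, ind (A0 ∩ Bp) q * ind (univ : Finset (Pd k)) q * ind V q) = ∑ q : Pd k, ind A0 q * ind Bp q * ind V q := by
      refine Finset.sum_congr rfl fun q _ => ?_
      rw [ind_inter_eq_mul, ind_univ_eq_one]; ring
    rw [e1, e2] at h
    exact h
  have hH1 : (∑ q : Pd k, ∑ r : Pd k, ind A0 q * ind B0 r * (if TotDist q r = true then (1:ℤ) else 0) * ind V q)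
      ≤ (2:ℤ) ^ k * (∑ q : Pd k, ind A0 q * ind B0 q * ind V q) := pairCount_le_harris hV hA0 hB0
  have hH2 : (∑ q : Pd k, ∑ r : Pd k, ind A0 q * ind B0 r * (if TotDist q r = true then (1:ℤ) else 0) * ind V r)
      ≤ (2:ℤ) ^ k * (∑ q : Pd k, ind A0 q * ind B0 q * ind V q) := pairCount_le_harris' hV hA0 hB0
  linarith

/-- **UNCONDITIONAL: the crossed family with `A₀ ∩ B′ ⊆ V` at the canonical certificate — every `k`, EVERY up-set `V`.**  For up-sets `V, A₀, B′ ⊆ B` with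
`A₀∩B′ ⊆ V` (e.g. `A₀ ⊆ V`, or `B′ ⊆ V`) and `V` good at `(A₀,B)`, `(A₀,B′)`, the co-count product `co(c, λ_V)` of `S = x∨y` and `V` satisfies (N) at the
crossed pair `P = {x≥1}×A₀`, `Q = {q∈B′} ∪ ({y≥1}×B)`. [this work] -/
theorem diagCert_coProduct_N_orTwo_crossed_canonical_of_FsubV (hS : ∀ ξ η : Pd 1, glue ξ η ∈ S ↔ (1 ≤ ξ 0 ∨ 1 ≤ η 0))
    (hFx : ∀ ξ η : Pd 1, glue ξ η ∈ Fx ↔ 1 ≤ ξ 0) (hGy : ∀ ξ η : Pd 1, glue ξ η ∈ Gy ↔ 1 ≤ η 0)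
    (hV : IsUpperSet (V : Set (Pd k))) (hA : ∀ σ z, glue σ z ∈ A ↔ (σ ∈ S ∧ z ∈ V))
    (dS : Pd (1 + 1) → ℤ) (hdS : dS (glue (fun _ => 0) (fun _ => 0)) = 0 ∧ dS (glue (fun _ => 0) (fun _ => 1)) = 4 ∧ dS (glue (fun _ => 0) (fun _ => 2)) = 4 ∧
      dS (glue (fun _ => 1) (fun _ => 0)) = 2 ∧ dS (glue (fun _ => 1) (fun _ => 1)) = 5 ∧ dS (glue (fun _ => 1) (fun _ => 2)) = 5 ∧
      dS (glue (fun _ => 2) (fun _ => 0)) = 2 ∧ dS (glue (fun _ => 2) (fun _ => 1)) = 5 ∧ dS (glue (fun _ => 2) (fun _ => 2)) = 5)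
    {A0 Bp B0 : Finset (Pd k)} (hA0 : IsUpperSet (A0 : Set (Pd k))) (hBp : IsUpperSet (Bp : Set (Pd k))) (hB0 : IsUpperSet (B0 : Set (Pd k)))
    (hsub : Bp ⊆ B0) (hFV : A0 ∩ Bp ⊆ V)
    (hGB : (∑ q ∈ A0, ∑ r ∈ B0, thetaVal V q r) ≤ ∑ q ∈ A0 ∩ B0, lamU V q)
    (hGBp : (∑ q ∈ A0, ∑ r ∈ Bp, thetaVal V q r) ≤ ∑ q ∈ A0 ∩ Bp, lamU V q)
    {P Q : Finset (Pd ((1 + 1) + k))} (hP : ∀ σ q, glue σ q ∈ P ↔ (σ ∈ Fx ∧ q ∈ A0)) (hQ : ∀ σ q, glue σ q ∈ Q ↔ (q ∈ Bp ∨ (σ ∈ Gy ∧ q ∈ B0))) :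
    (∑ x ∈ P, ∑ y ∈ Q, thetaVal A x y) ≤ ∑ x ∈ P ∩ Q, (2 * (2:ℤ) ^ ((1 + 1) + k) * (ind S (freeOf x) * ind V (cellOf x))
        - (2 * (2:ℤ) ^ (1 + 1) * ind S (freeOf x) - dS (freeOf x)) * (2 * (2:ℤ) ^ k * ind V (cellOf x) - lamU V (cellOf x))) :=
  diagCert_coProduct_N_orTwo_crossed_canonical hS hFx hGy hA dS hdS hsub hGB hGBp (cr_of_FsubV hV hA0 hBp hB0 hFV) hP hQ

/-- **The pattern functional there** (with (T) and the box for `dS`): `0 ≤ sStarD ((x∨y)×V) P Q` at every crossed pair with `A₀∩B′ ⊆ V`, for every up-set `V`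
good at `(A₀,B)` and `(A₀,B′)` — every `k`. [this work] -/
theorem sStarD_blockAnd_orTwo_crossed_FsubV_nonneg (hS : ∀ ξ η : Pd 1, glue ξ η ∈ S ↔ (1 ≤ ξ 0 ∨ 1 ≤ η 0))
    (hFx : ∀ ξ η : Pd 1, glue ξ η ∈ Fx ↔ 1 ≤ ξ 0) (hGy : ∀ ξ η : Pd 1, glue ξ η ∈ Gy ↔ 1 ≤ η 0)
    (hV : IsUpperSet (V : Set (Pd k))) (hA : ∀ σ z, glue σ z ∈ A ↔ (σ ∈ S ∧ z ∈ V))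
    (dS : Pd (1 + 1) → ℤ) (hdS : dS (glue (fun _ => 0) (fun _ => 0)) = 0 ∧ dS (glue (fun _ => 0) (fun _ => 1)) = 4 ∧ dS (glue (fun _ => 0) (fun _ => 2)) = 4 ∧
      dS (glue (fun _ => 1) (fun _ => 0)) = 2 ∧ dS (glue (fun _ => 1) (fun _ => 1)) = 5 ∧ dS (glue (fun _ => 1) (fun _ => 2)) = 5 ∧
      dS (glue (fun _ => 2) (fun _ => 0)) = 2 ∧ dS (glue (fun _ => 2) (fun _ => 1)) = 5 ∧ dS (glue (fun _ => 2) (fun _ => 2)) = 5)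
    (hTS : ∀ W : Finset (Pd (1 + 1)), IsUpperSet (W : Set (Pd (1 + 1))) → (∑ ξ ∈ W, dS ξ) ≤ ∑ ξ ∈ W, lamU S ξ)
    (hmS : ∀ ξ : Pd (1 + 1), dS ξ ≤ 2 * (2:ℤ) ^ (1 + 1) * ind S ξ)
    {A0 Bp B0 : Finset (Pd k)} (hA0 : IsUpperSet (A0 : Set (Pd k))) (hBp : IsUpperSet (Bp : Set (Pd k))) (hB0 : IsUpperSet (B0 : Set (Pd k)))
    (hsub : Bp ⊆ B0) (hFV : A0 ∩ Bp ⊆ V)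
    (hGB : (∑ q ∈ A0, ∑ r ∈ B0, thetaVal V q r) ≤ ∑ q ∈ A0 ∩ B0, lamU V q)
    (hGBp : (∑ q ∈ A0, ∑ r ∈ Bp, thetaVal V q r) ≤ ∑ q ∈ A0 ∩ Bp, lamU V q)
    {P Q : Finset (Pd ((1 + 1) + k))} (hPu : IsUpperSet (P : Set (Pd ((1 + 1) + k)))) (hQu : IsUpperSet (Q : Set (Pd ((1 + 1) + k))))
    (hP : ∀ σ q, glue σ q ∈ P ↔ (σ ∈ Fx ∧ q ∈ A0)) (hQ : ∀ σ q, glue σ q ∈ Q ↔ (q ∈ Bp ∨ (σ ∈ Gy ∧ q ∈ B0))) :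
    0 ≤ sStarD A P Q := by
  rw [sStarD_eq_sum_lamU_sub_sum_thetaVal]
  have hTV : ∀ W : Finset (Pd k), IsUpperSet (W : Set (Pd k)) → (∑ q ∈ W, lamU V q) ≤ ∑ q ∈ W, lamU V q := fun W _ => le_rfl
  have hT := diagCert_coProduct_T hA dS (lamU V) hTS hTV hmS (isUpperSet_inter_coe hPu hQu)
  have hN := diagCert_coProduct_N_orTwo_crossed_canonical_of_FsubV hS hFx hGy hV hA dS hdS hA0 hBp hB0 hsub hFV hGB hGBp hP hQ
  linarith

/-! ### Packaging: both unconditional sub-families from goodness of `V` in the usual `∀`-form -/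

/-- **THE CROSSED FAMILY AT THE CANONICAL CERTIFICATE FOR A GOOD INNER BLOCK (both proved sub-families, every `k`).**  Let `V ⊆ [3]^k` be an up-set that is GOOD
(`Θ_V(X×Y) ≤ λ_V(X∩Y)` for all up-sets `X, Y` — e.g. every up-set when `PatternPos k` holds), `S = x∨y` with `c = (0|4|2|5)`, `A = S×V`.  Then at every crossed pair
`P = {x≥1}×A₀`, `Q = {q∈B′} ∪ ({y≥1}×B)` (`A₀, B′ ⊆ B` up-sets) with `A₀∩V ⊆ B` OR `A₀∩B′ ⊆ V`, the pattern functional is nonnegative: `0 ≤ sStarD ((x∨y)×V) P Q`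
((T) and the box for `dS` as hypotheses, as in the companion files). [this work] -/
theorem sStarD_blockAnd_orTwo_crossed_nonneg_of_good (hS : ∀ ξ η : Pd 1, glue ξ η ∈ S ↔ (1 ≤ ξ 0 ∨ 1 ≤ η 0))
    (hFx : ∀ ξ η : Pd 1, glue ξ η ∈ Fx ↔ 1 ≤ ξ 0) (hGy : ∀ ξ η : Pd 1, glue ξ η ∈ Gy ↔ 1 ≤ η 0)
    (hV : IsUpperSet (V : Set (Pd k))) (hA : ∀ σ z, glue σ z ∈ A ↔ (σ ∈ S ∧ z ∈ V))
    (hgood : ∀ X Y : Finset (Pd k), IsUpperSet (X : Set (Pd k)) → IsUpperSet (Y : Set (Pd k)) →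
      (∑ q ∈ X, ∑ r ∈ Y, thetaVal V q r) ≤ ∑ q ∈ X ∩ Y, lamU V q)
    (dS : Pd (1 + 1) → ℤ) (hdS : dS (glue (fun _ => 0) (fun _ => 0)) = 0 ∧ dS (glue (fun _ => 0) (fun _ => 1)) = 4 ∧ dS (glue (fun _ => 0) (fun _ => 2)) = 4 ∧
      dS (glue (fun _ => 1) (fun _ => 0)) = 2 ∧ dS (glue (fun _ => 1) (fun _ => 1)) = 5 ∧ dS (glue (fun _ => 1) (fun _ => 2)) = 5 ∧
      dS (glue (fun _ => 2) (fun _ => 0)) = 2 ∧ dS (glue (fun _ => 2) (fun _ => 1)) = 5 ∧ dS (glue (fun _ => 2) (fun _ => 2)) = 5)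
    (hTS : ∀ W : Finset (Pd (1 + 1)), IsUpperSet (W : Set (Pd (1 + 1))) → (∑ ξ ∈ W, dS ξ) ≤ ∑ ξ ∈ W, lamU S ξ)
    (hmS : ∀ ξ : Pd (1 + 1), dS ξ ≤ 2 * (2:ℤ) ^ (1 + 1) * ind S ξ)
    {A0 Bp B0 : Finset (Pd k)} (hA0 : IsUpperSet (A0 : Set (Pd k))) (hBp : IsUpperSet (Bp : Set (Pd k))) (hB0 : IsUpperSet (B0 : Set (Pd k)))
    (hsub : Bp ⊆ B0) (hcase : A0 ∩ V ⊆ B0 ∨ A0 ∩ Bp ⊆ V)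
    {P Q : Finset (Pd ((1 + 1) + k))} (hPu : IsUpperSet (P : Set (Pd ((1 + 1) + k)))) (hQu : IsUpperSet (Q : Set (Pd ((1 + 1) + k))))
    (hP : ∀ σ q, glue σ q ∈ P ↔ (σ ∈ Fx ∧ q ∈ A0)) (hQ : ∀ σ q, glue σ q ∈ Q ↔ (q ∈ Bp ∨ (σ ∈ Gy ∧ q ∈ B0))) :
    0 ≤ sStarD A P Q := by
  rcases hcase with h1 | h2
  · exact sStarD_blockAnd_orTwo_crossed_cornerSub_nonneg hS hFx hGy hV hA dS hdS hTS hmS hA0 hBp hB0 hsub h1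
      (hgood A0 B0 hA0 hB0) (hgood A0 Bp hA0 hBp) hPu hQu hP hQ
  · exact sStarD_blockAnd_orTwo_crossed_FsubV_nonneg hS hFx hGy hV hA dS hdS hTS hmS hA0 hBp hB0 hsub h2
      (hgood A0 B0 hA0 hB0) (hgood A0 Bp hA0 hBp) hPu hQu hP hQ

end CrossedCanonicalSub

end Summit.CriticalPhenomena.PercolationContinuityZ3.Theorems.SahiGridPattern
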